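import Summits.Ventures.GridStability.Models.InverterNetwork

/-!
# GridStability/Models/InverterNetworkEdge — the droop microgrid in EDGE (angle-difference) variables: degree-3 exact recast

Cell `gridfusion` (LADDER-GRIDFUSION, APEX LINE rung G3.b «droop microgrid with Q–V dynamics —
census row first», director RULING 16 (b); seat model-3; `plan/PARTITION.md` §0 row `Models/`).
THREE COLUMNS: MODELLED column — an exact change of variables for the typed model
`DroopMicrogrid` (`Models/InverterNetwork.lean`, p464230, [cite: KunduEtAl2019, eqs. (4a)–(4c),
(5a)–(5b)]; MODEL-VALIDITY row **MV-6N** (model-2 v0.12: MV-6 common list + MV-2 Kron/load walls +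
line EM dynamics absent; voltage dynamics present)). No stability claim.

## The lever (census input for sos-4 / RULING 16 (b), after lit-2's edge formulation of the printed
first-order network, `Literature.MathematicalPhysics.PowerSystems.DroopNetwork.EdgeList`,
`injection_eq_div_edgeFlow`, [cite: SimpsonporcoDorflerBullo2013])

Recast per ORDERED PAIR / line `(i, j)`: `s_ij = sin(θ_i − θ_j)`, `c_ij = cos(θ_i − θ_j)`. Then the
printed lossy injections (5a)–(5b) are `P_i = Σ_j V_i V_j (G_ij c_ij + B_ij s_ij)`,
`Q_i = Σ_j V_i V_j (G_ij s_ij − B_ij c_ij)` — DEGREE 3 in `(s, c, V)` (degree 1 in `(s, c)` at frozen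
voltages), versus degree 4 (resp. 2) in the nodal variables `(s_i, c_i)` of `InverterNetwork.lean`
(`Ppoly`: terms `V_i V_j s_i c_j`). The kinematics stay quadratic: `ṡ_ij = c_ij (ω_i − ω_j)`,
`ċ_ij = −s_ij (ω_i − ω_j)` (`embeddingE`). Variables: `(s_ij, c_ij)` for the `m` lines actually present
(`G_ij = B_ij = 0` otherwise), `ω_i`, `V_i`: `2m + 2n`; constraints: `m` circles `s_ij² + c_ij² = 1`,
the pair relations `s_ji = −s_ij`, `c_ji = c_ij` (`pair_relations`, halving the pair variables), and
ONE closure identity per independent cycle (`cycle_closure`: `s_ik = s_ij c_jk + c_ij s_jk`,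
`c_ik = c_ij c_jk − s_ij s_jk`, degree 2) — NONE on a radial (tree) feeder. Dense Gram basis for
`−V̇` at `V`-degree 2: `C(2m + 2n + 2, 2)` — `n = 2, m = 1`: 28 (nodal: 165); `n = 3` tree: 66
(nodal: 455); `n = 3` triangle: 91 + 1 cycle multiplier. So the `n = 2` microgrid WITH voltage
dynamics meets RULING 16 (b)'s «block structure ≤ 35» trigger in these variables.
-/

noncomputable section

open Real Finset

namespace Summit.Ventures.GridStability.Models.DroopMicrogrid

variable {n : ℕ} (mg : DroopMicrogrid n)

/-! ## §1 Injections in pair variables -/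

/-- Active injection in the pair variables `s_ij = sin(θ_i − θ_j)`, `c_ij = cos(θ_i − θ_j)`:
`P_i = Σ_j V_i V_j (G_ij c_ij + B_ij s_ij)` — degree 3 in `(s, c, V)`, degree 1 in `(s, c)`. -/
def PpolyE (s c : Fin n → Fin n → ℝ) (V : Fin n → ℝ) (i : Fin n) : ℝ :=
  ∑ j, V i * V j * (mg.G i j * c i j + mg.B i j * s i j)

/-- Reactive injection in the pair variables: `Q_i = Σ_j V_i V_j (G_ij s_ij − B_ij c_ij)`. -/
def QpolyE (s c : Fin n → Fin n → ℝ) (V : Fin n → ℝ) (i : Fin n) : ℝ :=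
  ∑ j, V i * V j * (mg.G i j * s i j - mg.B i j * c i j)

/-- **Exact recast of (5a) in pair variables** (definitional: the printed injection IS a polynomial
in the sines and cosines of the angle DIFFERENCES). -/
theorem PpolyE_sin_cos (θ V : Fin n → ℝ) :
    mg.PpolyE (fun i j => sin (θ i - θ j)) (fun i j => cos (θ i - θ j)) V = mg.P θ V := by
  funext i; simp only [PpolyE, P]

/-- **Exact recast of (5b) in pair variables.** -/
theorem QpolyE_sin_cos (θ V : Fin n → ℝ) :
    mg.QpolyE (fun i j => sin (θ i - θ j)) (fun i j => cos (θ i - θ j)) V = mg.Q θ V := by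
  funext i; simp only [QpolyE, Q]

/-- The pair variables of the nodal recast: `s_ij = s_i c_j − c_i s_j`, `c_ij = c_i c_j + s_i s_j`
— so `PpolyE` is `Ppoly` (`InverterNetwork.lean`) after this degree-2 substitution; the edge
variables trade polynomial degree for (cycle) constraints. -/
theorem pair_of_nodal (θ : Fin n → ℝ) (i j : Fin n) :
    sin (θ i - θ j) = sin (θ i) * cos (θ j) - cos (θ i) * sin (θ j) ∧
      cos (θ i - θ j) = cos (θ i) * cos (θ j) + sin (θ i) * sin (θ j) :=
  ⟨sin_sub _ _, cos_sub _ _⟩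

/-! ## §2 Algebraic relations among the pair variables (the constraint set of the recast) -/

/-- Circle, antisymmetry/symmetry and diagonal relations of the pair variables:
`s_ij² + c_ij² = 1`, `s_ji = −s_ij`, `c_ji = c_ij`, `s_ii = 0`, `c_ii = 1`. -/
theorem pair_relations (θ : Fin n → ℝ) (i j : Fin n) :
    sin (θ i - θ j) ^ 2 + cos (θ i - θ j) ^ 2 = 1 ∧
      sin (θ j - θ i) = -sin (θ i - θ j) ∧ cos (θ j - θ i) = cos (θ i - θ j) ∧
      sin (θ i - θ i) = 0 ∧ cos (θ i - θ i) = 1 := by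
  refine ⟨sin_sq_add_cos_sq _, ?_, ?_, by simp, by simp⟩
  · rw [← sin_neg]; congr 1; ring
  · rw [← cos_neg]; congr 1; ring

/-- **Cycle closure** (one per independent cycle of the line graph): for any three nodes,
`s_ik = s_ij c_jk + c_ij s_jk` and `c_ik = c_ij c_jk − s_ij s_jk` — polynomial constraints of
degree 2 tying the pair variables around a triangle (longer cycles: iterate). On a TREE no such
constraint is needed (the `n − 1` edge differences are independent coordinates, cf. lit-2's
`DroopNetwork.EdgeList.exists_diff_eq`). -/
theorem cycle_closure (θ : Fin n → ℝ) (i j k : Fin n) :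
    sin (θ i - θ k) = sin (θ i - θ j) * cos (θ j - θ k) + cos (θ i - θ j) * sin (θ j - θ k) ∧
      cos (θ i - θ k) = cos (θ i - θ j) * cos (θ j - θ k) - sin (θ i - θ j) * sin (θ j - θ k) := by
  have h : θ i - θ k = (θ i - θ j) + (θ j - θ k) := by ring
  rw [h, sin_add, cos_add]
  exact ⟨rfl, rfl⟩

/-! ## §3 The recast field in pair variables and the exact embedding -/

/-- `s_ij`-components: `ṡ_ij = c_ij (ω_i − ω_j)` (degree 2). -/
def dSE (_mg : DroopMicrogrid n) (_s c : Fin n → Fin n → ℝ) (ω : Fin n → ℝ) (i j : Fin n) : ℝ :=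
  c i j * (ω i - ω j)

/-- `c_ij`-components: `ċ_ij = −s_ij (ω_i − ω_j)` (degree 2). -/
def dCE (_mg : DroopMicrogrid n) (s _c : Fin n → Fin n → ℝ) (ω : Fin n → ℝ) (i j : Fin n) : ℝ :=
  -(s i j * (ω i - ω j))

/-- `ω`-components: (4b) with `P_i` replaced by `PpolyE` — degree 3. -/
def dΩE (s c : Fin n → Fin n → ℝ) (ω V : Fin n → ℝ) (i : Fin n) : ℝ :=
  (-ω i + mg.kP i * (mg.Pset i - mg.PpolyE s c V i)) / mg.τP i

/-- `V`-components: (4c) with `Q_i` replaced by `QpolyE` — degree 3. -/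
def dVE (s c : Fin n → Fin n → ℝ) (_ω V : Fin n → ℝ) (i : Fin n) : ℝ :=
  (mg.Vset i - V i + mg.kQ i * (mg.Qset i - mg.QpolyE s c V i)) / mg.τQ i

/-- **Exact embedding in pair variables (chain rule).** Every solution `(θ, ω, V)` of the droop
microgrid (4a)–(4c) (derivatives at all times) is carried by
`(s_ij, c_ij, ω_i, V_i) = (sin(θ_i − θ_j), cos(θ_i − θ_j), ω_i, V_i)` to a solution of the
POLYNOMIAL system `(dSE, dCE, dΩE, dVE)` of degree 3, on the constraint set of §2. Hence an SOS
certificate for that system (with the circle / pair / cycle relations as equality multipliers) is a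
certificate about the microgrid MODEL (sufficiency). MODELLED: MV-6N. -/
theorem embeddingE {θ ω V : ℝ → Fin n → ℝ}
    (hθ : ∀ t i, HasDerivAt (fun τ => θ τ i) (mg.dθ (θ t, ω t, V t) i) t)
    (hω : ∀ t i, HasDerivAt (fun τ => ω τ i) (mg.dω (θ t, ω t, V t) i) t)
    (hV : ∀ t i, HasDerivAt (fun τ => V τ i) (mg.dV (θ t, ω t, V t) i) t) (t : ℝ) (i j : Fin n) :
    HasDerivAt (fun τ => sin (θ τ i - θ τ j))
        (mg.dSE (fun k l => sin (θ t k - θ t l)) (fun k l => cos (θ t k - θ t l)) (ω t) i j) t ∧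
      HasDerivAt (fun τ => cos (θ τ i - θ τ j))
        (mg.dCE (fun k l => sin (θ t k - θ t l)) (fun k l => cos (θ t k - θ t l)) (ω t) i j) t ∧
      HasDerivAt (fun τ => ω τ i)
        (mg.dΩE (fun k l => sin (θ t k - θ t l)) (fun k l => cos (θ t k - θ t l)) (ω t) (V t) i) t ∧
      HasDerivAt (fun τ => V τ i)
        (mg.dVE (fun k l => sin (θ t k - θ t l)) (fun k l => cos (θ t k - θ t l)) (ω t) (V t) i) t := by
  have h0 : HasDerivAt (fun τ => θ τ i - θ τ j)
      (mg.dθ (θ t, ω t, V t) i - mg.dθ (θ t, ω t, V t) j) t := (hθ t i).sub (hθ t j)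
  have hij : HasDerivAt (fun τ => θ τ i - θ τ j) (ω t i - ω t j) t := by
    simpa [dθ] using h0
  refine ⟨?_, ?_, ?_, ?_⟩
  · simpa [dSE, mul_comm] using hij.sin
  · simpa [dCE, mul_comm] using hij.cos
  · simpa [dΩE, dω, PpolyE_sin_cos] using hω t i
  · simpa [dVE, dV, QpolyE_sin_cos] using hV t i

end Summit.Ventures.GridStability.Models.DroopMicrogrid

end
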